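import Mathlib
import HarnessLib
import Literature.Analysis.FluidPDE.Tao2016AveragedNS.LocalCascadeSolutions
import Literature.Analysis.FluidPDE.Tao2016AveragedNS.RenormalisedCascadeWaves
import Literature.Analysis.FluidPDE.Tao2016AveragedNS.SelfSimilarCascadeBlowup
import Literature.Analysis.FluidPDE.Tao2016AveragedNS.SelfSimilarCascadeResidues
import Literature.Analysis.FluidPDE.Tao2016AveragedNS.BoundedEternalSolutions
import Summits.NavierStokesRegularity.NavierStokesRegularity.Theses.TaoLadderRungTwoBreak
import Summits.NavierStokesRegularity.NavierStokesRegularity.Theorems.TaoLadderRungTwoBreakNoSurvivingDSSOneActionFloor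
import Summits.NavierStokesRegularity.NavierStokesRegularity.Theorems.WakeRatchetBlockRatioLeOne

/-!
# The action floor on the SELF-SIMILAR STRATUM of the bounded inviscid Liouville predicate (ρ0)
# `NoSurvivingEternalBddOne` (stmt-NavierStokesRegularity-20451; stub `stub_noSurvivingEternalBddOne` of the
# crux `TaoLadderRungTwoBreak.NoSurvivingEternalViscBddOne`, stmt-NavierStokesRegularity-20419)

MODEL lattice ODEs only (Tao 2016 §4, §6.4; cell vocabulary `IsDSSWave`, `dssEmbed`, `EternalSurvivingFwd`,
`dssMu`, `dssAction`, `NoSurvivingEternalBdd`); nothing here is a statement about the Navier–Stokes equations;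
no summit, crux or rung LEAF is proved (`--supports stmt-NavierStokesRegularity-20419`).

The admissible DSS waves of a table are exactly the self-similar members of the hypothesis class of (ρ0)
(tree: `IsDSSWave.isEternal_dssEmbed`, `uniformBound_dssEmbed`); the planner's first rung for (ρ0) is (ρ0)
restricted to period-one embeddings (`children_rungs_plan.lean: stub_rho0_dssEmbed_period1`).  This file reads
the ACTION FLOOR of `…NoSurvivingDSSOneActionFloor` (`1 + μ ≤ H·e^{H}·|1 − μ|` for every non-trivial admissible
DSS wave of a cancelling table) on that stratum, for EVERY period and shape permutation:

* `one_le_physWeight_mul_exp_of_survivingFwd` — the converse of the tree's `eternalSurvivingFwd_dssEmbed`: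
  if the eternal solution carried by an admissible DSS wave is forward `(S_a)`-surviving then
  `(1+ε₀)^a · μ ≥ 1` (`physWeight a ε₀ · e^{2T} ≥ 1`), because the weighted energy of the embedding along the
  front is `((1+ε₀)^a μ)^n` times a bounded profile quantity (B′);
* `one_sub_dssMu_le_of_survivingFwd` — hence `1 − μ ≤ aε₀` (`a ≥ 0`), and with sub-unitarity of admissible
  waves (tree `IsDSSWave.dssMu_le_one`) the **action floor on the (ρ0) stratum**
  `survivingFwd_dssEmbed_action_floor : 1 ≤ aε₀ · H e^{H}` and its `a = 1` logarithmic form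
  `H ≥ log(1/ε₀) − log log(1/ε₀)` (`ε₀ ≤ e⁻¹`);
* `noSurvivingEternalBdd_rung_dss_boundedAction` — **the bounded-action slice of the (ρ0)-DSS rung is a
  THEOREM** (all periods; explicit threshold `εs = 1/(h₀e^{h₀}+1)`), and it is a case of (ρ0) and of the
  crux ⟨20419⟩ BY NAME (`dss_boundedAction_of_noSurvivingEternalBddOne`, `…_of_noSurvivingEternalViscBddOne`).
What (ρ0) adds on this stratum is the regime `dssAction ≳ log(1/ε₀)`; off the stratum (non-self-similar
bounded eternal solutions) the analogue of B′ + the whole-line throughput identity is the open piece.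
-/

noncomputable section

-- the summit and its single sub-problem share the name (CONVENTIONS §1)
set_option linter.dupNamespace false

namespace Summit.NavierStokesRegularity.NavierStokesRegularity.Theorems.NoSurvivingEternalViscBddOne.ActionFloorDSS

open Set Filter Topology MeasureTheory
open Literature.Analysis.FluidPDE Literature.Analysis.FluidPDE.TaoCascade
open Summit.NavierStokesRegularity.NavierStokesRegularity.Theses.TaoLadderRungTwoBreak
open Summit.NavierStokesRegularity.NavierStokesRegularity.Theorems.NoSurvivingDSSOne.ActionFloor

variable {ρ : Type*} [Fintype ρ] {m : ℕ}

/-- A uniform bound on the single weighted profile energies `e^{2x}‖Φ_r x‖²` of an admissible DSS wave of a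
cancelling table (from THEOREM B′: `ẽ ≤ e^{H} Rsq`).
[cite: Tao2016AveragedNS, §4 (4.2)–(4.3), Lemma 4.1 (4.8)–(4.10), §6.4; cell theorem B′] -/
theorem exists_weighted_profile_bound {ε₀ : ℝ} {α : Fin m → Fin m → Fin m → ℤ × ℤ × ℤ → ℝ}
    {π : Equiv.Perm ρ} {T : ℝ} {Φ : ρ → ℝ → Em m} (hc : IsCancellingCoeff α) (hW : IsDSSWave ε₀ α π T Φ) :
    ∃ P : ℝ, 0 ≤ P ∧ ∀ (r : ρ) (x : ℝ), Real.exp (2 * x) * ‖Φ r x‖ ^ 2 ≤ P := by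
  obtain ⟨Rsq, hR, hle, -⟩ := hW.theoremBprime hc
  have hRsq : 0 ≤ Rsq :=
    ge_of_tendsto' hR fun x => by unfold wEnergy; exact mul_nonneg (Real.exp_pos _).le (sEnergy_nonneg Φ x)
  refine ⟨Real.exp (dssAction ε₀ α T Φ) * Rsq, by positivity, fun r x => ?_⟩
  have h1 : ‖Φ r x‖ ^ 2 ≤ sEnergy Φ x :=
    Finset.single_le_sum (f := fun r' => ‖Φ r' x‖ ^ 2) (fun _ _ => by positivity) (Finset.mem_univ r)
  have h2 := hle x
  unfold wEnergy at h2
  calc Real.exp (2 * x) * ‖Φ r x‖ ^ 2 ≤ Real.exp (2 * 1 * x) * sEnergy Φ x := by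
        rw [show (2 : ℝ) * 1 * x = 2 * x by ring]
        exact mul_le_mul_of_nonneg_left h1 (Real.exp_pos _).le
    _ ≤ Real.exp (dssAction ε₀ α T Φ) * Rsq := h2

/-- **Survival of the carried eternal solution pins the ratio from below** (converse of the tree's
`eternalSurvivingFwd_dssEmbed`): if the eternal solution `dssEmbed π T Φ r₀` of an admissible DSS wave of a
cancelling table is forward `(S_a)`-surviving, then `physWeight a ε₀ · e^{2T} ≥ 1`, i.e. `(1+ε₀)^a μ ≥ 1`.
[cite: Tao2016AveragedNS, §4 Lemma 4.1 (4.8)–(4.10), §6.4; cell vocabulary (`EternalSurvivingFwd`, `dssEmbed`)] -/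
theorem one_le_physWeight_mul_exp_of_survivingFwd {ε₀ a : ℝ} {α : Fin m → Fin m → Fin m → ℤ × ℤ × ℤ → ℝ}
    {π : Equiv.Perm ρ} {T : ℝ} {Φ : ρ → ℝ → Em m} (hε : 0 < ε₀) (hc : IsCancellingCoeff α)
    (hW : IsDSSWave ε₀ α π T Φ) {r₀ : ρ} (hS : EternalSurvivingFwd a ε₀ (dssEmbed π T Φ r₀)) :
    1 ≤ physWeight a ε₀ * Real.exp (2 * T) := by
  obtain ⟨P, hP0, hP⟩ := exists_weighted_profile_bound hc hW
  obtain ⟨c, hc0, hcN⟩ := hS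
  set q := physWeight a ε₀ * Real.exp (2 * T) with hqdef
  have hq0 : 0 ≤ q := mul_nonneg (physWeight_nonneg hε.le) (Real.exp_pos _).le
  by_contra hlt
  push Not at hlt
  -- along the front the weighted energy of the embedding is `q^n ×` a bounded profile quantity
  have hstep : ∀ (n : ℕ) (σ : ℝ),
      physWeight a ε₀ ^ n * (Real.exp (2 * σ) * ‖dssEmbed π T Φ r₀ n σ‖ ^ 2) ≤ q ^ n * P := by
    intro n σ
    have hexp : Real.exp (2 * σ) = Real.exp (2 * T) ^ n * Real.exp (2 * (σ - n * T)) := by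
      rw [← Real.exp_nat_mul, ← Real.exp_add]; ring_nf
    have hemb : dssEmbed π T Φ r₀ n σ = Φ ((π ^ (n : ℤ)) r₀) (σ - n * T) := by
      simp only [dssEmbed, Int.cast_natCast]
    rw [hexp, hemb]
    calc physWeight a ε₀ ^ n * (Real.exp (2 * T) ^ n * Real.exp (2 * (σ - n * T))
          * ‖Φ ((π ^ (n : ℤ)) r₀) (σ - n * T)‖ ^ 2)
        = q ^ n * (Real.exp (2 * (σ - n * T)) * ‖Φ ((π ^ (n : ℤ)) r₀) (σ - n * T)‖ ^ 2) := by
          rw [hqdef, mul_pow]; ring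
      _ ≤ q ^ n * P := mul_le_mul_of_nonneg_left (hP _ _) (pow_nonneg hq0 n)
  -- `q^N P < c` for large `N`
  obtain ⟨N, hN⟩ : ∃ N : ℕ, q ^ N * P < c := by
    have ht : Tendsto (fun n : ℕ => q ^ n * P) atTop (𝓝 (0 * P)) :=
      (tendsto_pow_atTop_nhds_zero_of_lt_one hq0 hlt).mul_const P
    rw [zero_mul] at ht
    exact (ht.eventually (gt_mem_nhds hc0)).exists
  obtain ⟨n, hnN, σ, -, hcle⟩ := hcN N
  have hmono : q ^ n * P ≤ q ^ N * P :=
    mul_le_mul_of_nonneg_right (pow_le_pow_of_le_one hq0 hlt.le hnN) hP0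
  linarith [hstep n σ]

/-- Hence `(1+ε₀)^{-a} ≤ μ` and, for `a ≥ 0`, **`1 − μ ≤ aε₀`** for the DSS wave whose carried eternal solution
is forward `(S_a)`-surviving.
[cite: Tao2016AveragedNS, §4 Lemma 4.1 (4.8)–(4.10), §6.4; cell vocabulary (`dssMu`, `Surviving`)] -/
theorem one_sub_dssMu_le_of_survivingFwd {ε₀ a : ℝ} {α : Fin m → Fin m → Fin m → ℤ × ℤ × ℤ → ℝ}
    {π : Equiv.Perm ρ} {T : ℝ} {Φ : ρ → ℝ → Em m} (hε : 0 < ε₀) (ha : 0 ≤ a) (hc : IsCancellingCoeff α)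
    (hW : IsDSSWave ε₀ α π T Φ) {r₀ : ρ} (hS : EternalSurvivingFwd a ε₀ (dssEmbed π T Φ r₀)) :
    (1 + ε₀) ^ (-a) ≤ dssMu ε₀ T ∧ 1 - dssMu ε₀ T ≤ a * ε₀ := by
  have hq := one_le_physWeight_mul_exp_of_survivingFwd hε hc hW hS
  have hb : 0 < 1 + ε₀ := by linarith
  have hpa : 0 < (1 + ε₀) ^ a := Real.rpow_pos_of_pos hb a
  have hlow : (1 + ε₀) ^ (-a) ≤ dssMu ε₀ T := by
    have e1 : physWeight a ε₀ * Real.exp (2 * T) = (1 + ε₀) ^ a * dssMu ε₀ T := by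
      unfold physWeight dssMu; ring
    rw [e1] at hq
    rw [Real.rpow_neg hb.le, inv_le_iff_one_le_mul₀ hpa]
    linarith
  refine ⟨hlow, ?_⟩
  by_cases hμ1 : dssMu ε₀ T < 1
  · exact one_sub_dssMu_le_of_surviving hε ha ⟨hlow, hμ1⟩
  · push Not at hμ1
    nlinarith [hε]

/-- **THE ACTION FLOOR ON THE (ρ0) STRATUM.**  For `ε₀ > 0`, `a ≥ 0`, a cancelling table and an admissible DSS
wave (any period, shape permutation, delay) whose carried eternal solution `dssEmbed π T Φ r₀` — a uniformly
bounded admissible inviscid eternal solution — is forward `(S_a)`-surviving: `1 ≤ aε₀ · H e^{H}`,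
`H = dssAction ε₀ α T Φ`.
[cite: Tao2016AveragedNS, §4 (4.2)–(4.3), Lemma 4.1 (4.8)–(4.10), §6.4; cell theorems B/B′ + ActionFloor] -/
theorem survivingFwd_dssEmbed_action_floor {ε₀ a : ℝ} {α : Fin m → Fin m → Fin m → ℤ × ℤ × ℤ → ℝ}
    {π : Equiv.Perm ρ} {T : ℝ} {Φ : ρ → ℝ → Em m} (hε : 0 < ε₀) (ha : 0 ≤ a) (hc : IsCancellingCoeff α)
    (hW : IsDSSWave ε₀ α π T Φ) {r₀ : ρ} (hS : EternalSurvivingFwd a ε₀ (dssEmbed π T Φ r₀)) :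
    1 ≤ a * ε₀ * (dssAction ε₀ α T Φ * Real.exp (dssAction ε₀ α T Φ)) := by
  -- survival makes the wave non-trivial
  obtain ⟨c, hc0, hcN⟩ := hS
  obtain ⟨n, -, σ, -, hcle⟩ := hcN 0
  have hne' : dssEmbed π T Φ r₀ n σ ≠ 0 := by
    intro h0
    rw [h0, norm_zero] at hcle
    norm_num at hcle
    linarith
  have hne : ∃ r x, Φ r x ≠ 0 := ⟨(π ^ (n : ℤ)) r₀, σ - (n : ℤ) * T, by simpa [dssEmbed] using hne'⟩
  have hμle : dssMu ε₀ T ≤ 1 := hW.dssMu_le_one hε hc hne.choose_spec.choose_spec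
  have hgap := (one_sub_dssMu_le_of_survivingFwd hε ha hc hW ⟨c, hc0, hcN⟩).2
  have h := dssWave_one_add_dssMu_le hε hc hW hne
  have habs : |1 - dssMu ε₀ T| = 1 - dssMu ε₀ T := abs_of_nonneg (by linarith)
  rw [habs] at h
  have hμ0 : 0 < dssMu ε₀ T := dssMu_pos T (by linarith)
  have hHX : 0 ≤ dssAction ε₀ α T Φ * Real.exp (dssAction ε₀ α T Φ) :=
    mul_nonneg (dssAction_nonneg ε₀ α T Φ) (Real.exp_pos _).le
  calc (1 : ℝ) ≤ 1 + dssMu ε₀ T := by linarith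
    _ ≤ dssAction ε₀ α T Φ * Real.exp (dssAction ε₀ α T Φ) * (1 - dssMu ε₀ T) := h
    _ ≤ dssAction ε₀ α T Φ * Real.exp (dssAction ε₀ α T Φ) * (a * ε₀) :=
        mul_le_mul_of_nonneg_left hgap hHX
    _ = a * ε₀ * (dssAction ε₀ α T Φ * Real.exp (dssAction ε₀ α T Φ)) := by ring

/-- Logarithmic form at `a = 1`: a DSS member of the (ρ0) class whose carried eternal solution is forward
`(S₁)`-surviving, `ε₀ ≤ e⁻¹`, has `dssAction ≥ log(1/ε₀) − log log(1/ε₀)`.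
[cite: Tao2016AveragedNS, §4 (4.2)–(4.3), Lemma 4.1 (4.8)–(4.10), §6.4; cell theorems B/B′ + ActionFloor] -/
theorem survivingFwd_dssEmbed_action_ge_log {ε₀ : ℝ} {α : Fin m → Fin m → Fin m → ℤ × ℤ × ℤ → ℝ}
    {π : Equiv.Perm ρ} {T : ℝ} {Φ : ρ → ℝ → Em m} (hε : 0 < ε₀) (hsmall : ε₀ ≤ (Real.exp 1)⁻¹)
    (hc : IsCancellingCoeff α) (hW : IsDSSWave ε₀ α π T Φ) {r₀ : ρ}
    (hS : EternalSurvivingFwd 1 ε₀ (dssEmbed π T Φ r₀)) :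
    Real.log (1 / ε₀) - Real.log (Real.log (1 / ε₀)) ≤ dssAction ε₀ α T Φ := by
  have h := survivingFwd_dssEmbed_action_floor hε zero_le_one hc hW hS
  rw [one_mul] at h
  have hy : 1 / ε₀ ≤ dssAction ε₀ α T Φ * Real.exp (dssAction ε₀ α T Φ) := by
    rw [div_le_iff₀ hε]; linarith
  have hye : Real.exp 1 ≤ 1 / ε₀ := by
    rw [le_div_iff₀ hε]
    calc Real.exp 1 * ε₀ ≤ Real.exp 1 * (Real.exp 1)⁻¹ := mul_le_mul_of_nonneg_left hsmall (Real.exp_pos 1).le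
      _ = 1 := mul_inv_cancel₀ (Real.exp_pos 1).ne'
  exact log_sub_loglog_le_of_le_mul_exp (dssAction_nonneg ε₀ α T Φ) hye hy

/-! ## The bounded-action slice of the (ρ0)-DSS rung is a theorem, and a case of (ρ0) / the crux by name -/

/-- **(ρ0) HOLDS ON THE SELF-SIMILAR STRATUM FOR EVERY BOUNDED-ACTION CLASS** (the planner's rung
`stub_rho0_dssEmbed_period1` for ALL periods, restricted to action `≤ h₀`): for every `h₀ ≥ 0` and spread `R`,
with `εs = 1/(h₀e^{h₀}+1)`, for all `ε₀ ∈ (0, εs]` no admissible DSS wave (any period `q`, shape, delay) of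
action `≤ h₀` on a table of `InTableClass R` carries a forward `(S₁)`-surviving eternal solution.
[cite: Tao2016AveragedNS, §4 Thm. 4.2 (statement shape), (4.2)–(4.3), Lemma 4.1 (4.8)–(4.10), §6.4; cell theorems B/B′ + ActionFloor] -/
theorem noSurvivingEternalBdd_rung_dss_boundedAction (h₀ : ℝ) (hh₀ : 0 ≤ h₀) (R : ℝ) :
    ∃ εs : ℝ, 0 < εs ∧ ∀ ε₀ : ℝ, 0 < ε₀ → ε₀ ≤ εs →
      ∀ α : Fin 4 → Fin 4 → Fin 4 → ℤ × ℤ × ℤ → ℝ, InTableClass R α →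
        ∀ (q : ℕ) (π : Equiv.Perm (Fin q)) (T : ℝ) (Φ : Fin q → ℝ → Em 4), IsDSSWave ε₀ α π T Φ →
          dssAction ε₀ α T Φ ≤ h₀ → ∀ r : Fin q, ¬ EternalSurvivingFwd 1 ε₀ (dssEmbed π T Φ r) := by
  have hden : 0 < h₀ * Real.exp h₀ + 1 := by positivity
  refine ⟨1 / (h₀ * Real.exp h₀ + 1), by positivity, ?_⟩
  intro ε₀ hε₀ hle α hα q π T Φ hW hH r hS
  have h1 := survivingFwd_dssEmbed_action_floor hε₀ zero_le_one hα.2.1 hW hS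
  have h2 : dssAction ε₀ α T Φ * Real.exp (dssAction ε₀ α T Φ) ≤ h₀ * Real.exp h₀ :=
    mul_le_mul hH (Real.exp_le_exp.2 hH) (Real.exp_pos _).le ((dssAction_nonneg ε₀ α T Φ).trans hH)
  have h3 : (1 : ℝ) ≤ ε₀ * (h₀ * Real.exp h₀) := by
    calc (1 : ℝ) ≤ 1 * ε₀ * (dssAction ε₀ α T Φ * Real.exp (dssAction ε₀ α T Φ)) := h1
      _ = ε₀ * (dssAction ε₀ α T Φ * Real.exp (dssAction ε₀ α T Φ)) := by ring
      _ ≤ ε₀ * (h₀ * Real.exp h₀) := mul_le_mul_of_nonneg_left h2 hε₀.le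
  have h4 : ε₀ * (h₀ * Real.exp h₀) ≤ 1 / (h₀ * Real.exp h₀ + 1) * (h₀ * Real.exp h₀) :=
    mul_le_mul_of_nonneg_right hle (by positivity)
  have h5 : 1 / (h₀ * Real.exp h₀ + 1) * (h₀ * Real.exp h₀) < 1 := by
    rw [div_mul_eq_mul_div, one_mul, div_lt_one hden]; linarith
  linarith

/-- The slice IS a case of (ρ0) `stub_noSurvivingEternalBddOne : ∀ R ≥ 1, NoSurvivingEternalBdd R 1` (DSS
embeddings are bounded admissible inviscid eternal solutions).
[cite: Tao2016AveragedNS, §4 Thm. 4.2 (statement shape); cell vocabulary] -/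
theorem dss_boundedAction_of_noSurvivingEternalBddOne (h : ∀ R : ℝ, 1 ≤ R → NoSurvivingEternalBdd R 1)
    (h₀ R : ℝ) (hR : 1 ≤ R) :
    ∃ εs : ℝ, 0 < εs ∧ ∀ ε₀ : ℝ, 0 < ε₀ → ε₀ ≤ εs →
      ∀ α : Fin 4 → Fin 4 → Fin 4 → ℤ × ℤ × ℤ → ℝ, InTableClass R α →
        ∀ (q : ℕ) (π : Equiv.Perm (Fin q)) (T : ℝ) (Φ : Fin q → ℝ → Em 4), IsDSSWave ε₀ α π T Φ →
          dssAction ε₀ α T Φ ≤ h₀ → ∀ r : Fin q, ¬ EternalSurvivingFwd 1 ε₀ (dssEmbed π T Φ r) := by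
  obtain ⟨εs, hεs, H⟩ := h R hR
  exact ⟨εs, hεs, fun ε₀ hε₀ hle α hα q π T Φ hW _ r =>
    H ε₀ hε₀ hle α hα (dssEmbed π T Φ r) (hW.isEternal_dssEmbed r) (uniformBound_dssEmbed hW r)⟩

/-- … and of the crux ⟨stmt-NavierStokesRegularity-20419⟩ `NoSurvivingEternalViscBddOne` (its `ν̂ = 0` slice).
[cite: Tao2016AveragedNS, §4 Thm. 4.2 (statement shape); cell vocabulary] -/
theorem dss_boundedAction_of_noSurvivingEternalViscBddOne (h : NoSurvivingEternalViscBddOne) (h₀ R : ℝ)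
    (hR : 1 ≤ R) :
    ∃ εs : ℝ, 0 < εs ∧ ∀ ε₀ : ℝ, 0 < ε₀ → ε₀ ≤ εs →
      ∀ α : Fin 4 → Fin 4 → Fin 4 → ℤ × ℤ × ℤ → ℝ, InTableClass R α →
        ∀ (q : ℕ) (π : Equiv.Perm (Fin q)) (T : ℝ) (Φ : Fin q → ℝ → Em 4), IsDSSWave ε₀ α π T Φ →
          dssAction ε₀ α T Φ ≤ h₀ → ∀ r : Fin q, ¬ EternalSurvivingFwd 1 ε₀ (dssEmbed π T Φ r) := by
  obtain ⟨εs, hεs, H⟩ := h R hR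
  exact ⟨εs, hεs, fun ε₀ hε₀ hle α hα q π T Φ hW _ r =>
    H ε₀ hε₀ hle α hα 0 (dssEmbed π T Φ r) (hW.isEternal_dssEmbed r).isEternalVisc (uniformBound_dssEmbed hW r)⟩

end Summit.NavierStokesRegularity.NavierStokesRegularity.Theorems.NoSurvivingEternalViscBddOne.ActionFloorDSS

end
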